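/-
Copyright (c) 2026 the pub-hodgecm-mathlib formalisation cell (harness21).  Prover seat hodgecm-mathlib-F0P3a-p01 (g34), req620 Track A «(D-RAM) FOUR-FRAME» squad, unit U2H:
the (ρ2b′-X) child (U2H ED. 15 :418) — SOCKET (C) (type RamM) organ (C-0)(o6) «KLEIN DIFFERENT LETTERS» (socket-(C) lead LH4-p04 (g5) 2026-09-04T06:39Z «conductor–discriminant
letters — SUPPLIER WANTED»).  2026-09-04.
-/
import Literature.NumberTheory.LocalFields.WildQuadraticDatumNormOneQuotient     -- ★ `WildQuadraticDatum.v_sub_map_le_of_v_le_one` (every integer `x` has `|x − σx| ≤ |ϖ|^d`)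
import HarnessLib

/-!
# Crux `H413`, line LH4 «(D-RAM) FOUR-FRAME» road — unit U2H, (ρ2b′-X), SOCKET (C): THE KLEIN DIFFERENT LETTERS `d_Θ + d_τ = 2·d_E`

Cell `hodgecm-mathlib` (D-0151), FLOOR 0, crux item H413 = `stmt-HodgeConjecture-24833`, route of record `HCCMUnconditional`; squad F0∕P3c∕LH4; registered stub served:
`F0P3cDyRamFourFrameU2H.stub_U2H_fixedPointCensus_typeTwo_unit0` ((ρ2b′-X), U2H ED. 15 :418) through the typed bottom socket (C) `SOCKET-hOCC.v1` (869d0c15; type RamM,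
`|α − ρα| < 1`, `e(M∕F_v) = 4`), architecture LH4-p04 (g5) 2026-09-04T06:39Z, frame package (C-0), item (o6) «the conductor–discriminant letters `dΘ = 2g`, `dτ = 2s0`,
`d = g + s0`, `2d′ = dρ + dτ`, `dρ + 2d = dτ + 2d_K`».  THEOREMS ONLY (no `def`, no instance, no notation, no `sorry`); generic over a pair of valued fields `jE : E →+* M`
with ring endomorphisms `σ` of `E` and `ρ, Θ` of `M`; lane `--supports stmt-HodgeConjecture-24833 --as helper` (count-neutral).

WHAT THIS FILE DOES.  All five letters are instances of ONE identity — the transitivity of the different in the Klein four-group `{1, ρ, Θ, τ = Θρ}` acting on `M`, written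
in the cell's one-field currency (`d` of a ramified quadratic datum `(K, σ, ϖ, d)` is `|ϖ − σϖ| = |ϖ|^d`): for EVERY uniformiser `ϖM` of `M`,
**`|ϖM − ΘϖM| · |ϖM − Θ(ρϖM)| = |jE ϖ|^d`**, i.e. `d_Θ + d_τ = 2·d_E` when `|jE a| = |a|²` (`M ∕ jE(E)` ramified).  No class field theory:
* §1 `sub_mul_sub_eq` — the RING IDENTITY `(ϖM − ΘϖM)(ϖM − Θ(ρϖM)) = (s₁ − Θs₁)·ϖM − (s₂ − Θs₂)` with `s₁ = ϖM + ρϖM`, `s₂ = ϖM·ρϖM` (the `Θ`-conjugate factor `h^Θ(ϖM)` of the quartic minimal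
  polynomial, using `h(ϖM) = ϖM² − s₁ϖM + s₂ = 0`); `v_sub_mul_v_sub_eq_of_lt` — hence `|ϖM − ΘϖM|·|ϖM − Θ(ρϖM)| = |s₂ − Θs₂|` as soon as `|(s₁ − Θs₁)·ϖM| < |s₂ − Θs₂|`.
* §2 `v_sub_map_eq_of_uniformizer` — `d` does not depend on the uniformiser: `|y| = |ϖ| ⇒ |y − σy| = |ϖ|^d` (★ `v_sub_map_le_of_v_le_one` on the unit `y∕ϖ`).
* §3 `v_sub_mul_v_sub_eq` — THE LETTER: with `ρ`-fixed points `= jE(E)`, `Θ ∘ jE = jE ∘ σ`, `|jE a| = |a|²`, `|ρ z| = |z|` and the `E`-datum clauses `(hσσ, hfix, hϖ, hd)`: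
  `s₂` is `jE` of a UNIFORMISER of `E` (§2 gives `|s₂ − Θs₂| = |jEϖ|^d`) and `s₁` is `jE` of an INTEGER of `E` (★ minimality gives `|s₁ − Θs₁| ≤ |jEϖ|^d`), so §1 applies.
* §4 (ED. 2) `even_log_v_sub_map`, `even_of_v_sub_map_eq_pow` — PARITY: `z − Θz = 2·ξ·q` with `q` `Θ`-fixed (`Θξ = −ξ`), so `d_Θ` is EVEN once `|2|`, `|ξ|` and the
  `Θ`-fixed orders are even (type (C): `ξ := jE ω` resp. the doubly anti-fixed `ξ`, `|jE a| = |a|²`) — the lead's `dΘ = 2g`, `dτ = 2s0`.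
The same lemma at `(ρ, E, jE, σ) ↦ (Θ, K′, jK, σ′)` (third-field package ★ `…RamMAtThirdField`) reads `d_ρ + d_τ = 2·d′`, and at the fourth field `K = Fix τ` reads `d_ρ + d_Θ = 2·d_K`.
(R-26) model (REF5 R5-208): `M = ℚ₂(ζ₈) ⊃ E = ℚ₂(i)`, `ϖM = 1 − ζ₈`: `d_ρ = 4`, `d_Θ = d_τ = 2`, `d_E = 2`, `d′ = d_K = 3` — `2 + 2 = 2·2`, `4 + 2 = 2·3` ✓.
HONEST LABEL.  Count-neutral helper; (ρ2b′-X) stays an OPEN prover target; `HC_CM` is proved only modulo the 7 printed citations (2 remaining named inputs: hLiu418 =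
`stmt-HodgeConjecture-24832`, h413 = `stmt-HodgeConjecture-24833`) until rung 0 closes.

## References
* [Serre1979] J.-P. Serre, *Local Fields*, GTM 67 (1979), Ch. III §4 Prop. 8 (transitivity of the different), Ch. IV §1 Prop. 3–4 (`i_G` and the different), Ch. V §3.
* [NeukirchANT1999] J. Neukirch, *Algebraic Number Theory*, Grundlehren 322 (1999), Ch. III (2.2)–(2.4) (different of a tower).
-/

set_option autoImplicit false

noncomputable section

open WithZero
open scoped Valued

namespace Summit.HodgeConjecture.HodgeConjecture.Cruxes.H413.F0P3cDyRamKleinDifferentLetters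

/-! ## §1 The conjugate factor of the quartic minimal polynomial -/

section OneField

variable {M : Type} [Field M] (ρ Θ : M →+* M)

/-- **`h^Θ(ϖM) = (s₁ − Θs₁)·ϖM − (s₂ − Θs₂)`**: `(ϖM − ΘϖM)(ϖM − Θ(ρϖM)) = ((ϖM + ρϖM) − Θ(ϖM + ρϖM))·ϖM − (ϖM·ρϖM − Θ(ϖM·ρϖM))` (ring identity: `ϖM² = s₁ϖM − s₂`).
[cite: Serre1979, Ch. III §4 Prop. 8] -/
theorem sub_mul_sub_eq (ϖM : M) :
    (ϖM - Θ ϖM) * (ϖM - Θ (ρ ϖM)) = ((ϖM + ρ ϖM) - Θ (ϖM + ρ ϖM)) * ϖM - (ϖM * ρ ϖM - Θ (ϖM * ρ ϖM)) := by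
  rw [map_add, map_mul]; ring

variable [Valued M ℤᵐ⁰]

/-- **`|ϖM − ΘϖM|·|ϖM − Θ(ρϖM)| = |s₂ − Θs₂|` whenever `|(s₁ − Θs₁)·ϖM| < |s₂ − Θs₂|`** (ultrametric on §1). [cite: Serre1979, Ch. III §4 Prop. 8] -/
theorem v_sub_mul_v_sub_eq_of_lt {ϖM : M}
    (hlt : Valued.v (((ϖM + ρ ϖM) - Θ (ϖM + ρ ϖM)) * ϖM) < Valued.v (ϖM * ρ ϖM - Θ (ϖM * ρ ϖM))) :
    Valued.v (ϖM - Θ ϖM) * Valued.v (ϖM - Θ (ρ ϖM)) = Valued.v (ϖM * ρ ϖM - Θ (ϖM * ρ ϖM)) := by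
  rw [← Valuation.map_mul, sub_mul_sub_eq ρ Θ ϖM, Valuation.map_sub_swap, Valuation.map_sub_eq_of_lt_left _ hlt]

end OneField

/-! ## §2 `d` does not depend on the uniformiser -/

section Datum

variable {E : Type} [Field E] [Valued E ℤᵐ⁰] {σ : E →+* E} {ϖ : E} {d : ℕ}

/-- **UNIFORMISER-INDEPENDENCE OF `d`**: for a ramified quadratic datum `(E, σ, ϖ, d)` (`σσ = 1`, fixed elements of even valuation, `|ϖ| = exp(−1)`, `|ϖ − σϖ| = |ϖ|^d`,
`|σ·| = |·|`) and ANY `y` with `|y| = |ϖ|`: `|y − σy| = |ϖ|^d` (`y = uϖ`, `y − σy = u(ϖ − σϖ) + σϖ·(u − σu)`, `|u − σu| ≤ |ϖ|^d` by ★ minimality). [cite: Serre1979, Ch. V §3] -/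
theorem v_sub_map_eq_of_uniformizer (hσσ : ∀ x, σ (σ x) = x) (hvσ : ∀ x, Valued.v (σ x) = Valued.v x)
    (hfix : ∀ x : E, σ x = x → x ≠ 0 → ∃ n : ℤ, Valued.v x = exp (2 * n))
    (hϖ : Valued.v ϖ = exp (-1 : ℤ)) (hd : Valued.v (ϖ - σ ϖ) = Valued.v ϖ ^ d) {y : E} (hy : Valued.v y = Valued.v ϖ) :
    Valued.v (y - σ y) = Valued.v ϖ ^ d := by
  have hϖ0 : ϖ ≠ 0 := fun h => by rw [h, map_zero] at hϖ; exact (coe_ne_zero hϖ.symm).elim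
  set u : E := y / ϖ with hu
  have hvu : Valued.v u = 1 := by rw [hu, map_div₀, hy, div_self ((Valuation.ne_zero_iff _).2 hϖ0)]
  have hyu : y = u * ϖ := by rw [hu, div_mul_cancel₀ y hϖ0]
  have hdec : y - σ y = u * (ϖ - σ ϖ) + σ ϖ * (u - σ u) := by rw [hyu, map_mul]; ring
  have h1 : Valued.v (u * (ϖ - σ ϖ)) = Valued.v ϖ ^ d := by rw [Valuation.map_mul, hvu, one_mul, hd]
  have h2 : Valued.v (σ ϖ * (u - σ u)) < Valued.v ϖ ^ d := by
    rw [Valuation.map_mul, hvσ]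
    have hle := Literature.NumberTheory.LocalFields.WildQuadraticDatum.v_sub_map_le_of_v_le_one hσσ hfix hϖ hd hvu.le
    calc Valued.v ϖ * Valued.v (u - σ u) ≤ Valued.v ϖ * Valued.v ϖ ^ d := mul_le_mul_right hle _
      _ < 1 * Valued.v ϖ ^ d := by
          refine mul_lt_mul_of_pos_right ?_ (pow_pos ((Valuation.ne_zero_iff _).2 hϖ0 |> zero_lt_iff.2) d)
          rw [hϖ, ← exp_zero, exp_lt_exp]; norm_num
      _ = Valued.v ϖ ^ d := one_mul _
  rw [hdec, Valuation.map_add_eq_of_lt_left _ (by rw [h1]; exact h2), h1]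

end Datum

/-! ## §3 The letter `d_Θ + d_τ = 2·d_E` -/

section TwoFields

variable {E M : Type} [Field E] [Valued E ℤᵐ⁰] [Field M] [Valued M ℤᵐ⁰] (jE : E →+* M) {σ : E →+* E} (ρ Θ : M →+* M) {ϖ : E} {d : ℕ}

/-- **THE KLEIN DIFFERENT LETTER `|ϖM − ΘϖM|·|ϖM − Θ(ρϖM)| = |jE ϖ|^d` (`d_Θ + d_τ = 2·d_E`).**  `E`-datum `(σ, ϖ, d)`; `jE : E →+* M` with `ρ`-fixed points `= jE(E)`, `Θ ∘ jE = jE ∘ σ`,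
`|jE a| = |a|²` (`M ∕ E` ramified) and `|ρ·| = |·|`; `ϖM` any uniformiser of `M` (`|ϖM| = exp(−1)`).  [cite: Serre1979, Ch. III §4 Prop. 8; Ch. IV §1 Prop. 4]
[cite: NeukirchANT1999, Ch. III (2.2)–(2.4)] -/
theorem v_sub_mul_v_sub_eq (hσσ : ∀ x, σ (σ x) = x) (hvσ : ∀ x, Valued.v (σ x) = Valued.v x)
    (hfix : ∀ x : E, σ x = x → x ≠ 0 → ∃ n : ℤ, Valued.v x = exp (2 * n))
    (hϖ : Valued.v ϖ = exp (-1 : ℤ)) (hd : Valued.v (ϖ - σ ϖ) = Valued.v ϖ ^ d)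
    (hjfix : ∀ z : M, ρ z = z ↔ ∃ a, jE a = z) (hΘj : ∀ a, Θ (jE a) = jE (σ a))
    (hjv : ∀ a, Valued.v (jE a) = Valued.v a ^ 2) (hρρ : ∀ z, ρ (ρ z) = z) (hvρ : ∀ z, Valued.v (ρ z) = Valued.v z)
    {ϖM : M} (hϖM : Valued.v ϖM = exp (-1 : ℤ)) :
    Valued.v (ϖM - Θ ϖM) * Valued.v (ϖM - Θ (ρ ϖM)) = Valued.v (jE ϖ) ^ d := by
  have hϖ0 : ϖ ≠ 0 := fun h => by rw [h, map_zero] at hϖ; exact (coe_ne_zero hϖ.symm).elim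
  have hϖM0 : ϖM ≠ 0 := fun h => by rw [h, map_zero] at hϖM; exact (coe_ne_zero hϖM.symm).elim
  -- `s₁ = ϖM + ρϖM` and `s₂ = ϖM·ρϖM` are `ρ`-fixed, hence in `jE(E)`
  obtain ⟨a₁, ha₁⟩ := (hjfix (ϖM + ρ ϖM)).1 (by rw [map_add, hρρ, add_comm])
  obtain ⟨a₂, ha₂⟩ := (hjfix (ϖM * ρ ϖM)).1 (by rw [map_mul, hρρ, mul_comm])
  -- `a₂` is a uniformiser of `E`: `|jE a₂| = |ϖM|² = exp(−2)`
  have hva₂ : Valued.v a₂ = Valued.v ϖ := by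
    have h1 : Valued.v a₂ ^ 2 = Valued.v ϖ ^ 2 := by
      rw [← hjv, ha₂, Valuation.map_mul, hvρ, hϖM, hϖ, pow_two]
    exact (pow_left_inj₀ zero_le zero_le two_ne_zero).1 h1
  -- `a₁` is an integer of `E`: `|jE a₁| ≤ exp(−1) < 1`
  have hva₁ : Valued.v a₁ ≤ 1 := by
    have h1 : Valued.v a₁ ^ 2 ≤ exp (-1 : ℤ) := by
      rw [← hjv, ha₁]
      refine (Valuation.map_add _ _ _).trans ?_
      rw [hvρ, hϖM, max_self]
    by_contra hgt
    rw [not_le] at hgt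
    have h2 : (1 : ℤᵐ⁰) < Valued.v a₁ ^ 2 := one_lt_pow₀ hgt two_ne_zero
    have h3 : exp (-1 : ℤ) < (1 : ℤᵐ⁰) := by rw [← exp_zero, exp_lt_exp]; norm_num
    exact lt_irrefl _ ((h2.trans_le h1).trans h3)
  -- the two valuations
  have hs₂ : Valued.v (ϖM * ρ ϖM - Θ (ϖM * ρ ϖM)) = Valued.v (jE ϖ) ^ d := by
    rw [← ha₂, hΘj, ← map_sub, hjv, hjv, v_sub_map_eq_of_uniformizer hσσ hvσ hfix hϖ hd hva₂, ← pow_mul, ← pow_mul, mul_comm]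
  have hs₁ : Valued.v (((ϖM + ρ ϖM) - Θ (ϖM + ρ ϖM)) * ϖM) < Valued.v (ϖM * ρ ϖM - Θ (ϖM * ρ ϖM)) := by
    rw [hs₂, ← ha₁, hΘj, ← map_sub, Valuation.map_mul, hjv, hϖM]
    have hle := Literature.NumberTheory.LocalFields.WildQuadraticDatum.v_sub_map_le_of_v_le_one hσσ hfix hϖ hd hva₁
    have hpow : Valued.v (a₁ - σ a₁) ^ 2 ≤ Valued.v (jE ϖ) ^ d := by
      rw [hjv, ← pow_mul, mul_comm, pow_mul]
      exact pow_le_pow_left₀ zero_le hle 2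
    have hpos : (0 : ℤᵐ⁰) < Valued.v (jE ϖ) ^ d := pow_pos (by rw [hjv]; exact pow_pos ((Valuation.ne_zero_iff _).2 hϖ0 |> zero_lt_iff.2) 2) d
    calc Valued.v (a₁ - σ a₁) ^ 2 * exp (-1 : ℤ) ≤ Valued.v (jE ϖ) ^ d * exp (-1 : ℤ) := mul_le_mul_left hpow _
      _ < Valued.v (jE ϖ) ^ d * 1 := by
          refine mul_lt_mul_of_pos_left ?_ hpos
          rw [← exp_zero, exp_lt_exp]; norm_num
      _ = Valued.v (jE ϖ) ^ d := mul_one _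
  rw [v_sub_mul_v_sub_eq_of_lt ρ Θ hs₁, hs₂]

/-- **Integer form of the letter**: if `|ϖM − ΘϖM| = |ϖM|^{dΘ}` and `|ϖM − Θ(ρϖM)| = |ϖM|^{dτ}` then `dΘ + dτ = 2·d` (read `|jE ϖ| = |ϖM|²`). [cite: Serre1979, Ch. IV §1 Prop. 4] -/
theorem add_eq_two_mul (hσσ : ∀ x, σ (σ x) = x) (hvσ : ∀ x, Valued.v (σ x) = Valued.v x)
    (hfix : ∀ x : E, σ x = x → x ≠ 0 → ∃ n : ℤ, Valued.v x = exp (2 * n))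
    (hϖ : Valued.v ϖ = exp (-1 : ℤ)) (hd : Valued.v (ϖ - σ ϖ) = Valued.v ϖ ^ d)
    (hjfix : ∀ z : M, ρ z = z ↔ ∃ a, jE a = z) (hΘj : ∀ a, Θ (jE a) = jE (σ a))
    (hjv : ∀ a, Valued.v (jE a) = Valued.v a ^ 2) (hρρ : ∀ z, ρ (ρ z) = z) (hvρ : ∀ z, Valued.v (ρ z) = Valued.v z)
    {ϖM : M} (hϖM : Valued.v ϖM = exp (-1 : ℤ)) {dΘ dτ : ℕ}
    (hdΘ : Valued.v (ϖM - Θ ϖM) = Valued.v ϖM ^ dΘ) (hdτ : Valued.v (ϖM - Θ (ρ ϖM)) = Valued.v ϖM ^ dτ) : dΘ + dτ = 2 * d := by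
  have h := v_sub_mul_v_sub_eq jE ρ Θ hσσ hvσ hfix hϖ hd hjfix hΘj hjv hρρ hvρ hϖM
  rw [hdΘ, hdτ, hjv, hϖ, hϖM, ← pow_add, ← pow_mul, ← exp_nsmul, ← exp_nsmul] at h
  have h2 := exp_injective h
  simp only [smul_neg, nsmul_eq_mul, mul_one, neg_inj, Nat.cast_inj] at h2
  omega

end TwoFields

/-! ## §4 (ED. 2) Parity: `d_Θ`, `d_τ`, `d_ρ` are EVEN in type (C) -/

section Parity

variable {M : Type} [Field M] [Valued M ℤᵐ⁰] (Θ : M →+* M)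

omit [Valued M ℤᵐ⁰] in
/-- **`|z − Θz| = |2|·|ξ|·|q|` with `q := (z − Θz)∕(2ξ)` `Θ`-FIXED**, for any `ξ ≠ 0` with `Θξ = −ξ` (`ΘΘ = 1`, `2 ≠ 0`): the decomposition behind the parity of `d`.
[cite: Serre1979, Ch. IV §1 Prop. 4] -/
theorem map_div_two_mul_eq_self (hΘΘ : ∀ z, Θ (Θ z) = z) {ξ : M} (hΘξ : Θ ξ = -ξ) (hξ0 : ξ ≠ 0) (h2 : (2 : M) ≠ 0) (z : M) :
    Θ ((z - Θ z) / (2 * ξ)) = (z - Θ z) / (2 * ξ) := by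
  rw [map_div₀, map_sub, hΘΘ, map_mul, map_ofNat, hΘξ]
  field_simp
  ring

/-- **PARITY OF `d`**: if the `Θ`-fixed non-zero elements have EVEN order, `|2|` and `|ξ|` are even powers (`Θξ = −ξ`, `ξ ≠ 0`), then for every `z` with `Θz ≠ z`,
`|z − Θz|` is an even power (`z − Θz = 2·ξ·q`, `q` `Θ`-fixed).  In type (C): `ξ := jE ω` or the doubly anti-fixed `ξ` (`ξ² ∈ jE(ι F)`), `|2| = |jE 2|` — all even by `|jE a| = |a|²`.
[cite: Serre1979, Ch. IV §1 Prop. 4; Ch. IV §2] -/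
theorem even_log_v_sub_map (hΘΘ : ∀ z, Θ (Θ z) = z) (hfix : ∀ x : M, Θ x = x → x ≠ 0 → ∃ n : ℤ, Valued.v x = exp (2 * n))
    {ξ : M} (hΘξ : Θ ξ = -ξ) (hξ0 : ξ ≠ 0) {kξ : ℤ} (hvξ : Valued.v ξ = exp (2 * kξ))
    (h2 : (2 : M) ≠ 0) {k2 : ℤ} (hv2 : Valued.v (2 : M) = exp (2 * k2)) {z : M} (hz : Θ z ≠ z) :
    ∃ n : ℤ, Valued.v (z - Θ z) = exp (2 * n) := by
  set q : M := (z - Θ z) / (2 * ξ) with hq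
  have hΘq : Θ q = q := map_div_two_mul_eq_self Θ hΘΘ hΘξ hξ0 h2 z
  have hq0 : q ≠ 0 := by
    rw [hq]
    exact div_ne_zero (sub_ne_zero.2 (Ne.symm hz)) (mul_ne_zero h2 hξ0)
  obtain ⟨n, hn⟩ := hfix q hΘq hq0
  have hz' : z - Θ z = 2 * ξ * q := by rw [hq]; field_simp
  refine ⟨k2 + kξ + n, ?_⟩
  rw [hz', Valuation.map_mul, Valuation.map_mul, hv2, hvξ, hn, ← exp_add, ← exp_add]
  congr 1; ring

/-- **`d_Θ` IS EVEN**: with `|ϖM − ΘϖM| = |ϖM|^{dΘ}`, `|ϖM| = exp(−1)`, under the parity hypotheses of `even_log_v_sub_map`: `Even dΘ`. [cite: Serre1979, Ch. IV §1 Prop. 4] -/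
theorem even_of_v_sub_map_eq_pow (hΘΘ : ∀ z, Θ (Θ z) = z) (hfix : ∀ x : M, Θ x = x → x ≠ 0 → ∃ n : ℤ, Valued.v x = exp (2 * n))
    {ξ : M} (hΘξ : Θ ξ = -ξ) (hξ0 : ξ ≠ 0) {kξ : ℤ} (hvξ : Valued.v ξ = exp (2 * kξ))
    (h2 : (2 : M) ≠ 0) {k2 : ℤ} (hv2 : Valued.v (2 : M) = exp (2 * k2))
    {ϖM : M} (hϖM : Valued.v ϖM = exp (-1 : ℤ)) (hΘϖ : Θ ϖM ≠ ϖM) {dΘ : ℕ} (hdΘ : Valued.v (ϖM - Θ ϖM) = Valued.v ϖM ^ dΘ) :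
    Even dΘ := by
  obtain ⟨n, hn⟩ := even_log_v_sub_map Θ hΘΘ hfix hΘξ hξ0 hvξ h2 hv2 hΘϖ
  rw [hdΘ, hϖM, ← exp_nsmul] at hn
  have h := exp_injective hn
  simp only [smul_neg, nsmul_eq_mul, mul_one] at h
  exact ⟨(-n).toNat, by omega⟩

end Parity

end Summit.HodgeConjecture.HodgeConjecture.Cruxes.H413.F0P3cDyRamKleinDifferentLetters

end
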